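import Literature.NumberTheory.LFunctions.SelbergDelangeRieszExpansion
import HarnessLib

/-!
# One-sided Selberg–Delange for a difference of Riesz means, III: the scales and the first error terms
(crux stmt-Parity-11327, line `jensen-stieltjes-majorant`, stub `stub_rieszDiffEngine`)

Everything here is PROVED (theorems only).  Part of the one-sided Selberg–Delange bound for the
DIFFERENCE of two Riesz means `A₁(x+h) − A₁(x)` of a Dirichlet series `Σ a(n) n^{-s} = ζ(s)^z G(s)`
(data `SelbergDelange.RieszData R (4/5) B z a G` of the tree's contour engine
`Literature/NumberTheory/LFunctions/SelbergDelangeRieszExpansion.lean`, Montgomery–Vaughan §7.4,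
proof of Theorem 7.17): `‖A₁(x+h) − A₁(x)‖ ≤ h·x·(log x)^{Re z−1}·B·e^{c(1+R)^{3/2}}` for
`x e^{−(log log x)³} ≤ h ≤ x`, `1 ≤ R ≤ log log x` — the SIZE of the main term with every constant
explicit in `R`, no main term, no Hankel evaluation, no Taylor expansion at the branch point.

This file: the scales `L = log x = e^ℓ`, `T = exp(3ℓ³)`, elementary bounds for `(2x)^{1+a}`,
`(2x)^{1+b}`, `log(T+3)`, and the negligibility of the tails and of the horizontal sides
(`≤ x² B e^{−ℓ³ − (R+1)ℓ}`).

## References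

* [MontgomeryVaughan2007] H. L. Montgomery, R. C. Vaughan, *Multiplicative Number Theory I*,
  CUP 2007, §7.4, proof of Theorem 7.17 (pp. 177–178).
* [Tenenbaum2015] G. Tenenbaum, *Introduction to analytic and probabilistic number theory*, 3rd
  ed., AMS GSM 163, II.5 §§5.3–5.4.
-/

noncomputable section

open Complex Set MeasureTheory Filter Topology intervalIntegral Metric
open scoped Real Nat Interval
open Literature.Analysis.Complex Literature.Analysis.Complex.Keyhole
open Literature.NumberTheory.LFunctions Literature.NumberTheory.LFunctions.SelbergDelange

namespace Summit.Parity.BatemanHorn.Cruxes.LinearCappedRepulsion.JensenStieltjesMajorant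

namespace RieszDiff

/-! ### The parameters `L = log x = e^ℓ`, `T = exp(3ℓ³)` and the size of the error terms -/

/-- Numerical facts: `16 ≤ e³`, `e ≤ 3`, `log 2 ≤ 1`. [folklore] -/
theorem numerics : (16 : ℝ) ≤ Real.exp 3 ∧ Real.exp 1 ≤ 3 ∧ Real.log 2 ≤ 1 := by
  have h1 := Real.exp_one_gt_d9
  have h2 := Real.exp_one_lt_d9
  refine ⟨?_, by linarith, ?_⟩
  · have : Real.exp 3 = Real.exp 1 ^ 3 := by rw [← Real.exp_nat_mul]; norm_num
    rw [this]
    calc (16 : ℝ) ≤ (2.7182818283 : ℝ) ^ 3 := by norm_num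
      _ ≤ Real.exp 1 ^ 3 := pow_le_pow_left₀ (by norm_num) h1.le 3
  · have := Real.log_two_lt_d9; linarith

/-- **Basic facts about the scales** `L = log x`, `ℓ = log L ≥ 2`: `L = e^ℓ ≥ 7`, `x = e^L ≥ 2`,
`log(2x) ≤ 2L`. [folklore] -/
theorem scales {x L ℓ : ℝ} (hx : 1 < x) (hL : L = Real.log x) (hℓ : ℓ = Real.log L)
    (hℓ2 : 2 ≤ ℓ) :
    0 < x ∧ x = Real.exp L ∧ 0 < L ∧ L = Real.exp ℓ ∧ 7 ≤ L ∧ 2 ≤ x ∧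
      Real.log (2 * x) ≤ 2 * L := by
  have hx0 : 0 < x := by linarith
  have hL0 : 0 < L := by rw [hL]; exact Real.log_pos hx
  have hxL : x = Real.exp L := by rw [hL, Real.exp_log hx0]
  have hLℓ : L = Real.exp ℓ := by rw [hℓ, Real.exp_log hL0]
  have hL7 : 7 ≤ L := by
    rw [hLℓ]
    have h2 : Real.exp 2 ≤ Real.exp ℓ := Real.exp_le_exp.2 hℓ2
    have : (7 : ℝ) ≤ Real.exp 2 := by
      have := Real.exp_one_gt_d9
      have e : Real.exp 2 = Real.exp 1 ^ 2 := by rw [← Real.exp_nat_mul]; norm_num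
      rw [e]; nlinarith
    linarith
  have hx2 : 2 ≤ x := by
    rw [hxL]
    have : Real.exp 1 ≤ Real.exp L := Real.exp_le_exp.2 (by linarith)
    linarith [Real.add_one_le_exp (1 : ℝ)]
  have hlog2x : Real.log (2 * x) ≤ 2 * L := by
    rw [Real.log_mul two_ne_zero hx0.ne', ← hL]
    linarith [numerics.2.2]
  exact ⟨hx0, hxL, hL0, hLℓ, hL7, hx2, hlog2x⟩

/-- `(2x)^{1 + a} ≤ 4e² x²` for `a = 1 + 1/L`, `L = log x ≥ 1`. [folklore] -/
theorem two_mul_rpow_line_le {x L : ℝ} (hx : 1 < x) (hL : L = Real.log x) (hL1 : 1 ≤ L) :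
    (2 * x) ^ (1 + (1 + 1 / L)) ≤ 4 * Real.exp 2 * x ^ 2 := by
  have hx0 : 0 < x := by linarith
  have hL0 : 0 < L := by linarith
  have hxL : x = Real.exp L := by rw [hL, Real.exp_log hx0]
  rw [Real.rpow_def_of_pos (by positivity), Real.log_mul two_ne_zero hx0.ne', ← hL]
  have h4 : Real.exp (2 * Real.log 2) = 4 := by
    rw [show (2 : ℝ) * Real.log 2 = Real.log 4 by
      rw [show (4 : ℝ) = 2 ^ 2 by norm_num, Real.log_pow]; push_cast; ring]
    exact Real.exp_log (by norm_num)
  have e4 : (4 : ℝ) * Real.exp 2 * x ^ 2 = Real.exp (2 * Real.log 2 + 2 + 2 * L) := by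
    rw [Real.exp_add, Real.exp_add, h4, hxL, ← Real.exp_nat_mul]; push_cast; ring
  rw [e4, Real.exp_le_exp]
  have hexp : (Real.log 2 + L) * (1 + (1 + 1 / L)) = 2 * Real.log 2 + 2 * L + 1 + Real.log 2 / L := by
    field_simp; ring
  rw [hexp]
  have : Real.log 2 / L ≤ 1 := by
    rw [div_le_one hL0]; linarith [numerics.2.2]
  linarith

/-- `(2x)^{1 + b} ≤ 4 x² e^{−L(1 − b)}` for `b ≤ 1`, `L = log x`, `x > 1`. [folklore] -/
theorem two_mul_rpow_left_le {x L b : ℝ} (hx : 1 < x) (hL : L = Real.log x) (hb : b ≤ 1) :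
    (2 * x) ^ (1 + b) ≤ 4 * x ^ 2 * Real.exp (-(L * (1 - b))) := by
  have hx0 : 0 < x := by linarith
  have hL0 : 0 < L := by rw [hL]; exact Real.log_pos hx
  have hxL : x = Real.exp L := by rw [hL, Real.exp_log hx0]
  rw [Real.rpow_def_of_pos (by positivity), Real.log_mul two_ne_zero hx0.ne', ← hL]
  have h4 : Real.exp (2 * Real.log 2) = 4 := by
    rw [show (2 : ℝ) * Real.log 2 = Real.log 4 by
      rw [show (4 : ℝ) = 2 ^ 2 by norm_num, Real.log_pow]; push_cast; ring]
    exact Real.exp_log (by norm_num)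
  have e4 : (4 : ℝ) * x ^ 2 * Real.exp (-(L * (1 - b))) =
      Real.exp (2 * Real.log 2 + 2 * L + -(L * (1 - b))) := by
    rw [Real.exp_add, Real.exp_add, h4, hxL, ← Real.exp_nat_mul]; push_cast; ring
  rw [e4, Real.exp_le_exp]
  have h2 : 0 ≤ Real.log 2 := Real.log_nonneg one_le_two
  nlinarith [mul_le_mul_of_nonneg_right hb h2]

/-- The height `T = exp(3ℓ³)` (`ℓ ≥ 2`): `T ≥ 3`, `3ℓ³ ≤ log(T + 3) ≤ 3ℓ³ + 1`. [folklore] -/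
theorem height_bounds {ℓ T : ℝ} (hℓ2 : 2 ≤ ℓ) (hT : T = Real.exp (3 * ℓ ^ 3)) :
    3 ≤ T ∧ 3 * ℓ ^ 3 ≤ Real.log (T + 3) ∧ Real.log (T + 3) ≤ 3 * ℓ ^ 3 + 1 := by
  have hT0 : 0 < T := by rw [hT]; exact Real.exp_pos _
  have hℓ3 : (2 : ℝ) ^ 3 ≤ ℓ ^ 3 := pow_le_pow_left₀ (by norm_num) hℓ2 3
  norm_num at hℓ3
  have hT3 : 3 ≤ T := by
    rw [hT]
    have : Real.exp 3 ≤ Real.exp (3 * ℓ ^ 3) := Real.exp_le_exp.2 (by linarith)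
    linarith [numerics.1]
  refine ⟨hT3, ?_, ?_⟩
  · rw [Real.le_log_iff_exp_le (by linarith), ← hT]; linarith
  · rw [Real.log_le_iff_le_exp (by linarith), Real.exp_add, ← hT]
    nlinarith [Real.add_one_le_exp (1 : ℝ), Real.exp_pos (1 : ℝ)]

/-- **The tails are negligible**: `4·(2x)^{1+a} B L^R / T ≤ x² B e^{−ℓ³ − (R+1)ℓ}` for
`T = exp(3ℓ³)`, `0 ≤ R ≤ ℓ`, `ℓ = log log x ≥ 2`. [folklore] -/
theorem tails_le {x L ℓ R B T : ℝ} (hx : 1 < x) (hL : L = Real.log x) (hℓ : ℓ = Real.log L)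
    (hℓ2 : 2 ≤ ℓ) (hRℓ : R ≤ ℓ) (hB : 0 ≤ B) (hT : T = Real.exp (3 * ℓ ^ 3)) :
    4 * ((2 * x) ^ (1 + (1 + 1 / L)) * (B / (1 / L) ^ R) / T) ≤
      x ^ 2 * B * Real.exp (-ℓ ^ 3 - (R + 1) * ℓ) := by
  obtain ⟨hx0, hxL, hL0, hLℓ, hL7, hx2, -⟩ := scales hx hL hℓ hℓ2
  have hT0 : 0 < T := by rw [hT]; exact Real.exp_pos _
  have h2x := two_mul_rpow_line_le hx hL (by linarith)
  have hBL : B / (1 / L) ^ R = B * L ^ R := by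
    rw [Real.div_rpow zero_le_one hL0.le, Real.one_rpow]; field_simp
  have hLR : L ^ R ≤ Real.exp (ℓ ^ 2) := by
    rw [Real.rpow_def_of_pos hL0, ← hℓ, Real.exp_le_exp]; nlinarith
  have hTinv : 1 / T = Real.exp (-(3 * ℓ ^ 3)) := by rw [hT, Real.exp_neg]; field_simp
  -- LHS ≤ 16 e² x² B e^{ℓ²} e^{−3ℓ³}
  have h1 : 4 * ((2 * x) ^ (1 + (1 + 1 / L)) * (B / (1 / L) ^ R) / T) ≤
      16 * Real.exp 2 * x ^ 2 * B * Real.exp (ℓ ^ 2) * Real.exp (-(3 * ℓ ^ 3)) := by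
    rw [hBL, div_eq_mul_one_div _ T, hTinv]
    have : (2 * x) ^ (1 + (1 + 1 / L)) * (B * L ^ R) ≤ (4 * Real.exp 2 * x ^ 2) * (B * Real.exp (ℓ ^ 2)) :=
      mul_le_mul h2x (mul_le_mul_of_nonneg_left hLR hB) (by positivity) (by positivity)
    calc 4 * ((2 * x) ^ (1 + (1 + 1 / L)) * (B * L ^ R) * Real.exp (-(3 * ℓ ^ 3)))
        ≤ 4 * ((4 * Real.exp 2 * x ^ 2) * (B * Real.exp (ℓ ^ 2)) * Real.exp (-(3 * ℓ ^ 3))) := by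
          gcongr
      _ = _ := by ring
  refine h1.trans ?_
  -- 16 e² e^{ℓ²} e^{−3ℓ³} ≤ e^{−ℓ³ − (R+1)ℓ}
  have h16 : (16 : ℝ) * Real.exp 2 ≤ Real.exp 5 := by
    have : Real.exp 5 = Real.exp 3 * Real.exp 2 := by rw [← Real.exp_add]; norm_num
    rw [this]; exact mul_le_mul_of_nonneg_right numerics.1 (Real.exp_pos _).le
  have hexp : Real.exp 5 * Real.exp (ℓ ^ 2) * Real.exp (-(3 * ℓ ^ 3)) ≤
      Real.exp (-ℓ ^ 3 - (R + 1) * ℓ) := by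
    rw [← Real.exp_add, ← Real.exp_add, Real.exp_le_exp]
    nlinarith [mul_nonneg (sub_nonneg.2 hℓ2) (by positivity : (0:ℝ) ≤ 2 * ℓ ^ 2 + 2 * ℓ + 3),
      mul_le_mul_of_nonneg_right hRℓ (by linarith : (0:ℝ) ≤ ℓ)]
  calc 16 * Real.exp 2 * x ^ 2 * B * Real.exp (ℓ ^ 2) * Real.exp (-(3 * ℓ ^ 3))
      = x ^ 2 * B * ((16 * Real.exp 2) * Real.exp (ℓ ^ 2) * Real.exp (-(3 * ℓ ^ 3))) := by ring
    _ ≤ x ^ 2 * B * (Real.exp 5 * Real.exp (ℓ ^ 2) * Real.exp (-(3 * ℓ ^ 3))) := by gcongr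
    _ ≤ x ^ 2 * B * Real.exp (-ℓ ^ 3 - (R + 1) * ℓ) := by gcongr

/-- **The horizontal sides are negligible**:
`4 (a − b)((2x)^{1+a} e^{R C₀} log(T+3)^R B / T²) ≤ x² B e^{−ℓ³ − (R+1)ℓ}` once `ℓ ≥ C₀ + 3`. [folklore] -/
theorem hor_le {x L ℓ R B T C₀ b : ℝ} (hx : 1 < x) (hL : L = Real.log x) (hℓ : ℓ = Real.log L)
    (hℓ2 : 2 ≤ ℓ) (hℓC : C₀ + 3 ≤ ℓ) (hC₀ : 0 ≤ C₀) (hR0 : 0 ≤ R) (hRℓ : R ≤ ℓ) (hB : 0 ≤ B)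
    (hT : T = Real.exp (3 * ℓ ^ 3)) (hb0 : 0 ≤ b) (hb1 : b ≤ 1 + 1 / L) :
    4 * ((1 + 1 / L - b) * ((2 * x) ^ (1 + (1 + 1 / L)) *
      (Real.exp (R * C₀) * Real.log (T + 3) ^ R) * B / T ^ 2)) ≤
      x ^ 2 * B * Real.exp (-ℓ ^ 3 - (R + 1) * ℓ) := by
  obtain ⟨hx0, hxL, hL0, hLℓ, hL7, hx2, -⟩ := scales hx hL hℓ hℓ2
  obtain ⟨hT3, hlogT1, hlogT2⟩ := height_bounds hℓ2 hT
  have hT0 : 0 < T := by linarith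
  have h2x := two_mul_rpow_line_le hx hL (by linarith)
  have hab : 1 + 1 / L - b ≤ 2 := by
    have : 1 / L ≤ 1 := by rw [div_le_one hL0]; linarith
    linarith
  have hab0 : 0 ≤ 1 + 1 / L - b := by linarith
  -- log(T+3)^R ≤ exp(R log(4ℓ³)) ≤ exp(ℓ (log 4 + 3 log ℓ)) and log ℓ ≤ ℓ
  have hℓ3 : (2 : ℝ) ^ 3 ≤ ℓ ^ 3 := pow_le_pow_left₀ (by norm_num) hℓ2 3
  norm_num at hℓ3
  have hlogT0 : 0 < Real.log (T + 3) := by linarith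
  have hℓ0 : 0 < ℓ := by linarith
  have hlog4ℓ : Real.log (Real.log (T + 3)) ≤ 2 + 3 * ℓ := by
    have h4 : Real.log (T + 3) ≤ 4 * ℓ ^ 3 := by linarith
    calc Real.log (Real.log (T + 3)) ≤ Real.log (4 * ℓ ^ 3) := Real.log_le_log hlogT0 h4
      _ = Real.log 4 + 3 * Real.log ℓ := by
          rw [Real.log_mul (by norm_num) (by positivity), Real.log_pow]; push_cast; ring
      _ ≤ 2 + 3 * ℓ := by
          have h4' : Real.log 4 ≤ 2 := by
            have : Real.log 4 = 2 * Real.log 2 := by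
              rw [show (4:ℝ) = 2 ^ 2 by norm_num, Real.log_pow]; push_cast; ring
            rw [this]; linarith [numerics.2.2]
          have hℓlog : Real.log ℓ ≤ ℓ := (Real.log_le_sub_one_of_pos hℓ0).trans (by linarith)
          linarith
  have hlogTR : Real.log (T + 3) ^ R ≤ Real.exp (ℓ * (2 + 3 * ℓ)) := by
    rw [Real.rpow_def_of_pos hlogT0, Real.exp_le_exp]
    calc Real.log (Real.log (T + 3)) * R ≤ (2 + 3 * ℓ) * R :=
          mul_le_mul_of_nonneg_right hlog4ℓ hR0
      _ ≤ (2 + 3 * ℓ) * ℓ := mul_le_mul_of_nonneg_left hRℓ (by linarith)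
      _ = ℓ * (2 + 3 * ℓ) := by ring
  have hCf : Real.exp (R * C₀) ≤ Real.exp (ℓ * C₀) :=
    Real.exp_le_exp.2 (mul_le_mul_of_nonneg_right hRℓ hC₀)
  have hT2 : 1 / T ^ 2 = Real.exp (-(6 * ℓ ^ 3)) := by
    rw [hT, ← Real.exp_nat_mul, Real.exp_neg]; field_simp; ring_nf
  -- LHS ≤ 8 · 4e²x² · e^{ℓC₀} e^{ℓ(2+3ℓ)} B e^{−6ℓ³}
  have h1 : 4 * ((1 + 1 / L - b) * ((2 * x) ^ (1 + (1 + 1 / L)) *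
      (Real.exp (R * C₀) * Real.log (T + 3) ^ R) * B / T ^ 2)) ≤
      32 * Real.exp 2 * x ^ 2 * B * (Real.exp (ℓ * C₀) * Real.exp (ℓ * (2 + 3 * ℓ))) *
        Real.exp (-(6 * ℓ ^ 3)) := by
    rw [div_eq_mul_one_div _ (T ^ 2), hT2]
    have hprod : Real.exp (R * C₀) * Real.log (T + 3) ^ R ≤
        Real.exp (ℓ * C₀) * Real.exp (ℓ * (2 + 3 * ℓ)) :=
      mul_le_mul hCf hlogTR (by positivity) (by positivity)
    have hmain : (2 * x) ^ (1 + (1 + 1 / L)) * (Real.exp (R * C₀) * Real.log (T + 3) ^ R) * B ≤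
        (4 * Real.exp 2 * x ^ 2) * (Real.exp (ℓ * C₀) * Real.exp (ℓ * (2 + 3 * ℓ))) * B :=
      mul_le_mul_of_nonneg_right (mul_le_mul h2x hprod (by positivity) (by positivity)) hB
    calc 4 * ((1 + 1 / L - b) * ((2 * x) ^ (1 + (1 + 1 / L)) *
          (Real.exp (R * C₀) * Real.log (T + 3) ^ R) * B * Real.exp (-(6 * ℓ ^ 3))))
        ≤ 4 * (2 * ((4 * Real.exp 2 * x ^ 2) * (Real.exp (ℓ * C₀) * Real.exp (ℓ * (2 + 3 * ℓ))) * B *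
            Real.exp (-(6 * ℓ ^ 3)))) := by
          gcongr 4 * ?_
          exact mul_le_mul hab (mul_le_mul_of_nonneg_right hmain (Real.exp_pos _).le)
            (by positivity) (by norm_num)
      _ = _ := by ring
  refine h1.trans ?_
  have h32 : (32 : ℝ) * Real.exp 2 ≤ Real.exp 6 := by
    have e : Real.exp 6 = Real.exp 3 * Real.exp 1 * Real.exp 2 := by
      rw [← Real.exp_add, ← Real.exp_add]; norm_num
    rw [e]
    have h16 := numerics.1
    have h1' : (2 : ℝ) ≤ Real.exp 1 := by linarith [Real.add_one_le_exp (1:ℝ)]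
    have h32' : (32 : ℝ) ≤ Real.exp 3 * Real.exp 1 := by
      nlinarith [mul_nonneg (sub_nonneg.2 h16) (sub_nonneg.2 h1')]
    exact mul_le_mul_of_nonneg_right h32' (Real.exp_pos 2).le
  have hexp : Real.exp 6 * (Real.exp (ℓ * C₀) * Real.exp (ℓ * (2 + 3 * ℓ))) * Real.exp (-(6 * ℓ ^ 3)) ≤
      Real.exp (-ℓ ^ 3 - (R + 1) * ℓ) := by
    rw [← Real.exp_add, ← Real.exp_add, ← Real.exp_add, Real.exp_le_exp]
    -- need: 6 + ℓC₀ + 2ℓ + 3ℓ² − 6ℓ³ ≤ −ℓ³ − (R+1)ℓ, using R ≤ ℓ, C₀ ≤ ℓ − 3, ℓ ≥ 2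
    have hC : ℓ * C₀ ≤ ℓ * (ℓ - 3) := mul_le_mul_of_nonneg_left (by linarith) hℓ0.le
    have hRl : (R + 1) * ℓ ≤ (ℓ + 1) * ℓ := mul_le_mul_of_nonneg_right (by linarith) hℓ0.le
    nlinarith [mul_nonneg (sub_nonneg.2 hℓ2) (by positivity : (0:ℝ) ≤ ℓ ^ 2),
      mul_nonneg (sub_nonneg.2 hℓ2) (by positivity : (0:ℝ) ≤ ℓ)]
  calc 32 * Real.exp 2 * x ^ 2 * B * (Real.exp (ℓ * C₀) * Real.exp (ℓ * (2 + 3 * ℓ))) *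
        Real.exp (-(6 * ℓ ^ 3))
      = x ^ 2 * B * ((32 * Real.exp 2) * (Real.exp (ℓ * C₀) * Real.exp (ℓ * (2 + 3 * ℓ))) *
          Real.exp (-(6 * ℓ ^ 3))) := by ring
    _ ≤ x ^ 2 * B * (Real.exp 6 * (Real.exp (ℓ * C₀) * Real.exp (ℓ * (2 + 3 * ℓ))) *
          Real.exp (-(6 * ℓ ^ 3))) := by gcongr
    _ ≤ x ^ 2 * B * Real.exp (-ℓ ^ 3 - (R + 1) * ℓ) := by gcongr

/-- `e^{R C₀} log(T+3)^R ≤ e^{ℓ C₀} e^{ℓ(2 + 3ℓ)}` for `0 ≤ R ≤ ℓ`, `T = exp(3ℓ³)`, `ℓ ≥ 2`. [folklore] -/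
theorem far_factor_le {ℓ R T C₀ : ℝ} (hℓ2 : 2 ≤ ℓ) (hC₀ : 0 ≤ C₀) (hR0 : 0 ≤ R) (hRℓ : R ≤ ℓ)
    (hT : T = Real.exp (3 * ℓ ^ 3)) :
    Real.exp (R * C₀) * Real.log (T + 3) ^ R ≤ Real.exp (ℓ * C₀) * Real.exp (ℓ * (2 + 3 * ℓ)) := by
  obtain ⟨hT3, hlogT1, hlogT2⟩ := height_bounds hℓ2 hT
  have hℓ3 : (2 : ℝ) ^ 3 ≤ ℓ ^ 3 := pow_le_pow_left₀ (by norm_num) hℓ2 3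
  norm_num at hℓ3
  have hlogT0 : 0 < Real.log (T + 3) := by linarith
  have hℓ0 : 0 < ℓ := by linarith
  have hlog4ℓ : Real.log (Real.log (T + 3)) ≤ 2 + 3 * ℓ := by
    have h4 : Real.log (T + 3) ≤ 4 * ℓ ^ 3 := by linarith
    calc Real.log (Real.log (T + 3)) ≤ Real.log (4 * ℓ ^ 3) := Real.log_le_log hlogT0 h4
      _ = Real.log 4 + 3 * Real.log ℓ := by
          rw [Real.log_mul (by norm_num) (by positivity), Real.log_pow]; push_cast; ring
      _ ≤ 2 + 3 * ℓ := by
          have h4' : Real.log 4 ≤ 2 := by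
            have : Real.log 4 = 2 * Real.log 2 := by
              rw [show (4:ℝ) = 2 ^ 2 by norm_num, Real.log_pow]; push_cast; ring
            rw [this]; linarith [numerics.2.2]
          have hℓlog : Real.log ℓ ≤ ℓ := (Real.log_le_sub_one_of_pos hℓ0).trans (by linarith)
          linarith
  have hlogTR : Real.log (T + 3) ^ R ≤ Real.exp (ℓ * (2 + 3 * ℓ)) := by
    rw [Real.rpow_def_of_pos hlogT0, Real.exp_le_exp]
    calc Real.log (Real.log (T + 3)) * R ≤ (2 + 3 * ℓ) * R :=
          mul_le_mul_of_nonneg_right hlog4ℓ hR0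
      _ ≤ (2 + 3 * ℓ) * ℓ := mul_le_mul_of_nonneg_left hRℓ (by linarith)
      _ = ℓ * (2 + 3 * ℓ) := by ring
  have hCf : Real.exp (R * C₀) ≤ Real.exp (ℓ * C₀) :=
    Real.exp_le_exp.2 (mul_le_mul_of_nonneg_right hRℓ hC₀)
  exact mul_le_mul hCf hlogTR (by positivity) (by positivity)

end RieszDiff

/-- **Registered sub-goal `stub_rieszDiffTails` of crux stmt-Parity-11327** (part of `stub_rieszDiffEngine`):
the negligibility of the tails (`RieszDiff.tails_le`, ∀-closed). [cite: MontgomeryVaughan2007, §7.4 pp. 177–178] -/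
theorem stub_rieszDiffTails :
      ∀ (x L ℓ R B T : ℝ), 1 < x → L = Real.log x → ℓ = Real.log L → 2 ≤ ℓ → R ≤ ℓ → 0 ≤ B → T =
      Real.exp (3 * ℓ ^ 3) → 4 * ((2 * x) ^ (1 + (1 + 1 / L)) * (B / (1 / L) ^ R) / T) ≤ x ^ 2 * B *
      Real.exp (-ℓ ^ 3 - (R + 1) * ℓ) :=
  fun _ _ _ _ _ _ hx hL hℓ hℓ2 hRℓ hB hT => RieszDiff.tails_le hx hL hℓ hℓ2 hRℓ hB hT

end Summit.Parity.BatemanHorn.Cruxes.LinearCappedRepulsion.JensenStieltjesMajorant
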